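import Literature.AlgebraicGeometry.HodgeTheory.SmoothHypersurfaceHodgeBettiNumbers
import Literature.AlgebraicGeometry.HodgeTheory.SmoothHypersurfaceBettiNumbersConstant
import Literature.AlgebraicGeometry.HodgeTheory.FermatEvenMiddleBettiNumber
import HarnessLib

/-!
# The second Betti number of a smooth surface of degree `d` in `ℙ³` is `d³ − 4d² + 6d − 2` — discharge of the named fact
# `EisenbudHarris2016_surface_secondBettiNumber` (Eisenbud–Harris 2016, Example 5.24 / Table 5.1)

Family `hodge`, layer `Literature/AlgebraicGeometry/HodgeTheory`. PROOF FILE (theorems only: no definition, no named fact,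
no instance; D-0026 net debt `−1`: the named fact `EisenbudHarris2016_surface_secondBettiNumber` of
`SmoothHypersurfaceHodgeBettiNumbers` becomes a theorem). D. Eisenbud, J. Harris, *3264 and All That* (2016), §5.7 Example
5.24 and Table 5.1: for a smooth surface `X ⊂ ℙ³` of degree `d`, `b₂(X) = χ_top(X) − 2 = d³ − 4d² + 6d − 2` (cubic `7`,
quartic `22`, quintic `53`). The print argument is `χ_top = deg c₂(T_X)` + Lefschetz; the proof HERE is topological and
entirely inside the tree:

1. **all smooth surfaces of degree `d` have the same Betti numbers** — they are fibres of the universal smooth hypersurface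
   `π : 𝒴_U → U` over the path-connected `U(ℂ)`, and `R² π_* ℂ` is a local system by Ehresmann's theorem (PROVED in the
   tree: `UniversalHypersurface.isCohomologicallyLocallyTrivialOn_family`), so `b₂(X_F) = b₂(X_G)`
   (`finrank_bettiCohomology_hypersurface_eq_of_isNonsingularForm`, file `SmoothHypersurfaceBettiNumbersConstant`);
2. **the Fermat surface `X²_d : Σ xᵢ^d = 0` has `b₂ = d³ − 4d² + 6d − 2`** — Shioda's character decomposition
   `H²(X²_d(ℂ); ℂ) = ⊕_α V(α)` with `dim V(α) = 1` exactly on `𝔄²_d ∪ {0}`, `|𝔄²_d| = (d − 1)(d² − 3d + 3)` (all PROVED in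
   the tree from the Pham–Brieskorn join; `finrank_bettiCohomology_fermatSurface_two`, file `FermatEvenMiddleBettiNumber`).

* **`finrank_bettiCohomology_two_hypersurface_of_isNonsingularForm`** — `dim_ℚ H²(X_F(ℂ); ℚ) = d³ + 6d − (4d² + 2)` for every
  nonsingular quaternary form `F` of degree `d ≥ 1` (the smoothness hypothesis `IsSmoothProjective 2 X_F` of the named fact is
  not even needed).
* **`EisenbudHarris2016_surface_secondBettiNumber_holds`** — the named fact, VERBATIM.

Consumer: the K1-A binder `stub_surfaceSecondBetti` of crux `VeryGeneralDeckCommutatorsInHg` (stmt-HodgeConjecture-19544,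
route `HodgeConjecture/CyclicUnitaryPowers`), which now closes BY NAME; written by the prover seat `hodge-nonav-prover-Bx`
(g10).

## References

* [EisenbudHarris2016] D. Eisenbud, J. Harris, 3264 and All That — A Second Course in Algebraic Geometry, CUP 2016, §5.7
  Example 5.24 and Table 5.1 (held text p0210–p0211).
* [VoisinHodgeI2002] C. Voisin, Hodge Theory and Complex Algebraic Geometry I, CUP 2002, Thm. 9.3, §9.2.1.
* [Shioda1979HodgeFermat] T. Shioda, The Hodge conjecture for Fermat varieties, Math. Ann. 245 (1979), §1 (1.3)–(1.4).
-/

noncomputable section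

open CategoryTheory AlgebraicGeometry MvPolynomial

namespace Literature.AlgebraicGeometry.HodgeTheory

open Literature.AlgebraicGeometry.Motives

/-- **`b₂(X_F) = d³ − 4d² + 6d − 2` for every nonsingular quaternary form `F` of degree `d ≥ 1`** (written
`d³ + 6d − (4d² + 2)`): `b₂(X_F) = b₂(X²_d)` (all smooth degree-`d` surfaces are fibres of the universal family over the
path-connected `U(ℂ)`, Ehresmann) and the Fermat value. [cite: EisenbudHarris2016, Example 5.24 and Table 5.1]
[cite: VoisinHodgeI2002, Thm. 9.3 and §9.2.1] [cite: Shioda1979HodgeFermat, §1 (1.3)–(1.4)] -/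
theorem finrank_bettiCohomology_two_hypersurface_of_isNonsingularForm {d : ℕ} (hd : 1 ≤ d)
    (F : MvPolynomial (Fin (2 + 2)) ℂ) (hF : F.IsHomogeneous d) (hFns : SmoothHypersurface.IsNonsingularForm ℂ F) :
    Module.finrank ℚ ↥(bettiCohomology (SmoothHypersurface.hypersurface F) 2) = d ^ 3 + 6 * d - (4 * d ^ 2 + 2) := by
  haveI : NeZero d := ⟨by omega⟩
  have hfermat : SmoothHypersurface.IsNonsingularForm ℂ (fermatPolynomial ℂ 2 d) :=
    SmoothHypersurface.isNonsingularForm_sum_X_pow (Nat.cast_ne_zero.mpr (NeZero.ne d))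
  rw [finrank_bettiCohomology_hypersurface_eq_of_isNonsingularForm (n := 2) hd hF hFns
    (isHomogeneous_fermatPolynomial 2 d) hfermat 2]
  exact finrank_bettiCohomology_fermatSurface_two

/-- **The second Betti number of a smooth surface of degree `d` in `ℙ³`: `b₂(X_F) = d³ − 4d² + 6d − 2` — the named fact
`EisenbudHarris2016_surface_secondBettiNumber`, DISCHARGED** (Eisenbud–Harris, *3264 and All That*, Example 5.24 /
Table 5.1: cubic surface `b₂ = 7`, quartic `22`, quintic `53`). Proof: Ehresmann on the universal smooth hypersurface
(`b₂` is constant over the path-connected parameter space) and Shioda's eigenspace decomposition of the Fermat surface —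
all tree theorems; no cited input. [cite: EisenbudHarris2016, Example 5.24 and Table 5.1 (held text p0210–p0211)]
[cite: VoisinHodgeI2002, Thm. 9.3 and §9.2.1] [cite: Shioda1979HodgeFermat, §1 (1.3)–(1.4)] -/
theorem EisenbudHarris2016_surface_secondBettiNumber_holds : EisenbudHarris2016_surface_secondBettiNumber := by
  intro d hd F hF hFns _hX
  exact finrank_bettiCohomology_two_hypersurface_of_isNonsingularForm hd F hF hFns

end Literature.AlgebraicGeometry.HodgeTheory

end
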